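import Literature.NumberTheory.LFunctions.WeilSelbergMinorantTest
import Literature.NumberTheory.LFunctions.WeilArchModulatedGrowth
import Summits.RiemannHypothesis.RiemannHypothesis.Theorems.WindowTracePrime2.Negative.Modulation
import HarnessLib

/-!
# `stub_tailSlack`: every positive representer of `W` on a window is super-Landau at infinity

Registered stub `stub_tailSlack` of the line `anchor-float` of the crux
`Summit.RiemannHypothesis.RiemannHypothesis.Theses.SpectralTrace.WindowTracePrime2`
(stmt-RiemannHypothesis-11196). If a positive Borel measure `μ` on `ℝ` represents the Weil
functional on the Weil tests supported in a window `[-L₁, L₁]` with `L₁ > log 3`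
(`W(g) = ∫ ĝ(1/2 + it) dμ(t)`, integrably), then for some height `H ≥ 1`, some `δ > 0` and a
sub-Nyquist scale `0 < w < 2π/log 3`, `μ[T, T + w] ≥ (1 + δ)(log 3/π)·w` for `T ≥ H` and
`μ[T - w, T] ≥ (1 + δ)(log 3/π)·w` for `T ≤ -H` (in fact `μ[T, T + w] ≫ log |T|`).

Proof. Pick `w ∈ (2π/L₁, 2π/log 3)`. The smoothed Selberg minorant
(`Literature.NumberTheory.LFunctions.exists_isWeilTest_weilMellin_le_indicator`) is a Weil test
`g` supported in `[-L₁, L₁]` with real transform `ĝ(1/2 + it) ≤ 𝟙_{[0,w]}(t)` and `Re g(0) > 0`.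
Its modulation `g_T(x) = g(x)e^{-iTx}` (`Negative.Modulation`: a test with the same support and
transform `ĝ(1/2 + i(t - T)) ≤ 𝟙_{[T, T+w]}(t)`) gives, by positivity of `μ` and the representation,
`μ[T, T + w] ≥ Re W(g_T)` (`ofReal_le_measure_Icc_of_repr`); and `Re W(g_T) ≥ Re g(0)·log|T| - P`
for `|T| ≥ 2` (`re_weilFunctional_modulate_ge_log`: polar and prime terms are bounded uniformly in
`T`, `Negative.norm_weilPolarTerm_modulate_le`, `Negative.norm_weilPrimeTerm_modulate_le`, while the
archimedean integral is `2π g(0) log|T| + O(1)`,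
`Literature.NumberTheory.LFunctions.exists_norm_weilArchIntegral_modulate_sub_le`). Taking
`H = max(2, exp((V + P)/Re g(0)))` with `V = 2(log 3/π)w` gives both clauses with `δ = 1` (the
negative side at the height `T - w`).
-/

-- the Summit path `RiemannHypothesis/RiemannHypothesis` (summit = problem) repeats a namespace component
set_option linter.dupNamespace false

noncomputable section

open Complex Set MeasureTheory Filter
open scoped Real ArithmeticFunction.vonMangoldt

namespace Summit.RiemannHypothesis.RiemannHypothesis.Theorems.AnchorFloat

open Literature.NumberTheory.LFunctions
open Summit.RiemannHypothesis.RiemannHypothesis.Theorems.WindowTracePrime2.Negative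

/-- **Lower bound for `Re W(g_T)`.** For a Weil test `g` there is `P` with
`Re W(g_T) ≥ Re g(0) · log |T| - P` for all `|T| ≥ 2`, `g_T(t) = g(t)e^{-iTt}`: the polar and
prime terms of `W(g_T)` are bounded uniformly in `T` and the archimedean term is
`g(0) log |T| + O(1)`. [folklore] -/
theorem re_weilFunctional_modulate_ge_log {g : ℝ → ℂ} (hg : IsWeilTest g) :
    ∃ P : ℝ, ∀ T : ℝ, 2 ≤ |T| →
      (g 0).re * Real.log |T| - P ≤
        (weilFunctional (fun t => g t * cexp (((-(T * t) : ℝ) : ℂ) * I))).re := by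
  obtain ⟨C, hC⟩ := exists_norm_weilArchIntegral_modulate_sub_le hg
  set M : ℝ := ∑' n : ℕ, ‖((Λ n : ℝ) : ℂ) / (Real.sqrt n : ℂ)‖ *
    (‖g (Real.log n)‖ + ‖g (-Real.log n)‖) with hM
  refine ⟨2 * weilL1W (1 / 2) g + M + C / (2 * π) + ‖g 0‖ * Real.log π, fun T hT => ?_⟩
  set gT : ℝ → ℂ := fun t => g t * cexp (((-(T * t) : ℝ) : ℂ) * I) with hgT
  have hpol : ‖weilPolarTerm gT‖ ≤ 2 * weilL1W (1 / 2) g := norm_weilPolarTerm_modulate_le hg T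
  have hpri : ‖weilPrimeTerm gT‖ ≤ M := norm_weilPrimeTerm_modulate_le hg.2 T
  have harch : ‖weilArchIntegral gT - 2 * π * g 0 * Real.log |T|‖ ≤ C := hC T hT
  have hgT0 : gT 0 = g 0 := by simp [hgT]
  -- real parts of the three terms
  have hW : (weilFunctional gT).re =
      (weilPolarTerm gT).re - (weilPrimeTerm gT).re + (weilArchTerm gT).re := by
    simp [weilFunctional]
  have hre_arch : (weilArchTerm gT).re =
      1 / (2 * π) * (weilArchIntegral gT).re - (g 0).re * Real.log π := by
    rw [weilArchTerm, hgT0]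
    have e1 : (1 / (2 * π) : ℂ) = ((1 / (2 * π) : ℝ) : ℂ) := by push_cast; ring
    rw [e1, Complex.sub_re, Complex.re_ofReal_mul, Complex.re_mul_ofReal]
  have hmain : 2 * π * (g 0).re * Real.log |T| - C ≤ (weilArchIntegral gT).re := by
    have h1 : |(weilArchIntegral gT - 2 * π * g 0 * Real.log |T|).re| ≤ C :=
      (Complex.abs_re_le_norm _).trans harch
    have e : (2 * π * g 0 * Real.log |T| : ℂ).re = 2 * π * (g 0).re * Real.log |T| := by
      have : (2 * π * g 0 * Real.log |T| : ℂ) = ((2 * π * Real.log |T| : ℝ) : ℂ) * g 0 := by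
        push_cast; ring
      rw [this, Complex.re_ofReal_mul]; ring
    rw [Complex.sub_re, e] at h1
    have := (abs_le.1 h1).1
    linarith
  have h1 : -(2 * weilL1W (1 / 2) g) ≤ (weilPolarTerm gT).re := by
    have := Complex.abs_re_le_norm (weilPolarTerm gT)
    linarith [neg_abs_le (weilPolarTerm gT).re]
  have h2 : -M ≤ -(weilPrimeTerm gT).re := by
    have := Complex.abs_re_le_norm (weilPrimeTerm gT)
    linarith [le_abs_self (weilPrimeTerm gT).re]
  have h3 : (g 0).re * Real.log π ≤ ‖g 0‖ * Real.log π := by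
    have hlogπ : 0 < Real.log π := Real.log_pos (by linarith [Real.pi_gt_three])
    exact mul_le_mul_of_nonneg_right ((le_abs_self _).trans (Complex.abs_re_le_norm _)) hlogπ.le
  have hπ : 0 < 1 / (2 * π) := by positivity
  have h4 := mul_le_mul_of_nonneg_left hmain hπ.le
  have e4 : 1 / (2 * π) * (2 * π * (g 0).re * Real.log |T| - C) =
      (g 0).re * Real.log |T| - C / (2 * π) := by
    field_simp
  rw [e4] at h4
  rw [hW, hre_arch]
  linarith

/-- **From the representation to local mass.** If `μ` represents `W` on the Weil tests supported
in `[-L₁, L₁]`, `g` is such a test with real transform `ĝ(1/2 + it) ≤ 𝟙_{[0,w]}(t)`, and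
`c ≤ Re W(g_T)` for the modulated test `g_T(t) = g(t)e^{-iTt}`, then `c ≤ μ[T, T + w]`
(positivity of `μ`: `Re W(g_T) = ∫ Re ĝ(1/2 + i(t - T)) dμ ≤ ∫ 𝟙_{[T,T+w]} dμ`). [folklore] -/
theorem ofReal_le_measure_Icc_of_repr {μ : Measure ℝ} {L₁ : ℝ}
    (hrep : ∀ g : ℝ → ℂ, IsWeilTest g → tsupport g ⊆ Icc (-L₁) L₁ →
      Integrable (fun t : ℝ => weilMellin g (1 / 2 + (t : ℂ) * I)) μ ∧
        weilFunctional g = ∫ t, weilMellin g (1 / 2 + (t : ℂ) * I) ∂μ)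
    {g : ℝ → ℂ} (hg : IsWeilTest g) (hgs : tsupport g ⊆ Icc (-L₁) L₁) {w : ℝ}
    (hline : ∀ t : ℝ, (weilMellin g (1 / 2 + t * I)).im = 0 ∧
      (weilMellin g (1 / 2 + t * I)).re ≤ (Icc 0 w).indicator (fun _ => (1 : ℝ)) t)
    {T c : ℝ} (hc : c ≤ (weilFunctional (fun t => g t * cexp (((-(T * t) : ℝ) : ℂ) * I))).re) :
    ENNReal.ofReal c ≤ μ (Icc T (T + w)) := by
  by_cases htop : μ (Icc T (T + w)) = ⊤
  · rw [htop]; exact le_top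
  set gT : ℝ → ℂ := fun t => g t * cexp (((-(T * t) : ℝ) : ℂ) * I) with hgT
  obtain ⟨hint, hWeq⟩ := hrep gT (isWeilTest_modulate hg T) ((tsupport_modulate_subset g T).trans hgs)
  -- the transform of `g_T` on the line is dominated by the indicator of `[T, T + w]`
  have hpt : ∀ t : ℝ, (weilMellin gT (1 / 2 + (t : ℂ) * I)).re ≤ (Icc T (T + w)).indicator 1 t := by
    intro t
    have hmod : weilMellin gT (1 / 2 + (t : ℂ) * I) = weilMellin g (1 / 2 + ((t - T : ℝ) : ℂ) * I) := by
      rw [hgT, weilMellin_modulate]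
      congr 1
      push_cast
      ring
    rw [hmod]
    refine ((hline (t - T)).2).trans (le_of_eq ?_)
    by_cases ht : t ∈ Icc T (T + w)
    · have ht' : t - T ∈ Icc 0 w := by
        simp only [mem_Icc] at ht ⊢; constructor <;> linarith [ht.1, ht.2]
      simp [ht, ht']
    · have ht' : t - T ∉ Icc 0 w := by
        intro h
        simp only [mem_Icc] at ht h
        exact ht ⟨by linarith [h.1], by linarith [h.2]⟩
      simp [ht, ht']
  -- integrate against `μ`
  have hind : Integrable ((Icc T (T + w)).indicator (1 : ℝ → ℝ)) μ :=
    (integrable_indicator_iff measurableSet_Icc).2 (integrableOn_const (hs := htop))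
  have hre : (weilFunctional gT).re = ∫ t, (weilMellin gT (1 / 2 + (t : ℂ) * I)).re ∂μ := by
    rw [hWeq]
    have h := integral_re hint
    simp only [RCLike.re_to_complex] at h
    exact h.symm
  have hle : (weilFunctional gT).re ≤ μ.real (Icc T (T + w)) := by
    rw [hre, ← integral_indicator_one measurableSet_Icc]
    exact integral_mono hint.re hind hpt
  calc ENNReal.ofReal c ≤ ENNReal.ofReal (μ.real (Icc T (T + w))) :=
        ENNReal.ofReal_le_ofReal (hc.trans hle)
    _ = μ (Icc T (T + w)) := by rw [measureReal_def, ENNReal.ofReal_toReal htop]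

/-- **`stub_tailSlack`** (line `anchor-float`, crux `WindowTracePrime2`): every positive measure
representing the Weil functional on the Weil tests supported in a window `[-L₁, L₁]`,
`L₁ > log 3`, has local mass at least `(1 + δ)(log 3/π)·w` on every interval of some
sub-Nyquist length `w < 2π/log 3` beyond some height `H`, on both sides (smoothed Selberg
minorants modulated to height `T`: `μ[T, T+w] ≥ Re W(g_T) = Re g(0) log|T| + O(1)`).
[cite: Vaaler1985, Thm. 8] -/
theorem stub_tailSlack :
    ∀ (μ : MeasureTheory.Measure ℝ) (L₁ : ℝ), Real.log 3 < L₁ →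
      (∀ g : ℝ → ℂ, Literature.NumberTheory.LFunctions.IsWeilTest g →
        tsupport g ⊆ Set.Icc (-L₁) L₁ →
        MeasureTheory.Integrable
            (fun t : ℝ => Literature.NumberTheory.LFunctions.weilMellin g (1 / 2 + (t : ℂ) * Complex.I)) μ ∧
          Literature.NumberTheory.LFunctions.weilFunctional g =
            ∫ t, Literature.NumberTheory.LFunctions.weilMellin g (1 / 2 + (t : ℂ) * Complex.I) ∂μ) →
      ∃ (H δ w : ℝ), 1 ≤ H ∧ 0 < δ ∧ 0 < w ∧ w < 2 * Real.pi / Real.log 3 ∧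
        (∀ T : ℝ, H ≤ T →
          ENNReal.ofReal ((1 + δ) * (Real.log 3 / Real.pi) * w) ≤ μ (Set.Icc T (T + w))) ∧
        (∀ T : ℝ, T ≤ -H →
          ENNReal.ofReal ((1 + δ) * (Real.log 3 / Real.pi) * w) ≤ μ (Set.Icc (T - w) T)) := by
  intro μ L₁ hL₁ hrep
  have hlog3 : 0 < Real.log 3 := Real.log_pos (by norm_num)
  have hL₁0 : 0 < L₁ := hlog3.trans hL₁
  -- the sub-Nyquist scale `w ∈ (2π/L₁, 2π/log 3)`
  set w : ℝ := (2 * π / L₁ + 2 * π / Real.log 3) / 2 with hw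
  have hcmp : 2 * π / L₁ < 2 * π / Real.log 3 := div_lt_div_of_pos_left (by positivity) hlog3 hL₁
  have hw1 : 2 * π / L₁ < w := by rw [hw]; linarith
  have hw2 : w < 2 * π / Real.log 3 := by rw [hw]; linarith
  have hw0 : 0 < w := lt_trans (by positivity) hw1
  -- the smoothed Selberg minorant and the growth of `Re W(g_T)`
  obtain ⟨g, hg, hgs, hg0, hline⟩ := exists_isWeilTest_weilMellin_le_indicator hL₁0 hw1
  obtain ⟨P, hP⟩ := re_weilFunctional_modulate_ge_log hg
  -- the height
  set V : ℝ := (1 + 1) * (Real.log 3 / π) * w with hV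
  set H : ℝ := max 2 (Real.exp ((V + P) / (g 0).re)) with hH
  have hH2 : 2 ≤ H := le_max_left _ _
  have hkey : ∀ T : ℝ, H ≤ |T| →
      V ≤ (weilFunctional (fun t => g t * cexp (((-(T * t) : ℝ) : ℂ) * I))).re := by
    intro T hT
    have hT2 : 2 ≤ |T| := hH2.trans hT
    have h1 := hP T hT2
    have hlog : (V + P) / (g 0).re ≤ Real.log |T| := by
      rw [Real.le_log_iff_exp_le (by linarith)]
      exact (le_max_right _ _).trans hT
    have h2 := (div_le_iff₀ hg0).1 hlog
    nlinarith
  refine ⟨H, 1, w, by linarith, one_pos, hw0, hw2, fun T hT => ?_, fun T hT => ?_⟩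
  · exact ofReal_le_measure_Icc_of_repr hrep hg hgs hline
      (hkey T (by rw [abs_of_nonneg (by linarith)]; exact hT))
  · have h := ofReal_le_measure_Icc_of_repr hrep hg hgs hline (T := T - w)
      (hkey (T - w) (by rw [abs_of_nonpos (by linarith)]; linarith))
    rwa [sub_add_cancel] at h

end Summit.RiemannHypothesis.RiemannHypothesis.Theorems.AnchorFloat

end
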